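import Literature.Analysis.FluidPDE.SawtoothCascade

/-!
# K2 lane (route-2 `SawtoothPulseCascade`, crux dir `K1LocalisedCascade`): algebra of the Kelvin–Helmholtz SHEET BLOCK (S2 groundwork)

Helper file of the K2 lane (planner p4 g14's line `bellman-weight`, stub S2 `KHSheetLyapunov` / `KHSheetAbsolute` of
`Cruxes/K1LocalisedCascade/K2ControlSketch.lean`; ACL item stmt-AnomalousDissipation-19491). For the line `k` with Bloch phase `β` the sheet
amplitudes obey `q′ = X q` with `X q = ik·(−p q₀ − 2S q₁, 2S̄ q₀ + p q₁)`, `p = π/2 + 2Σ₀`, `Σ₀ = sawSigma0 k β`, `S = sawS k β`, and the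
energy Gram is `M = [[m, −S], [−S̄, m]]`, `m = −Σ₀` (p4's `khField`, `khForm`; written out here, no definitions). Exact identities:
* `khBlock_sq` — `X² = −k²·c²(k,β)·Id` (`c² = sawC2 = p² − 4|S|²`): the block is a 2×2 "Dirac" operator, so its propagator is
  `cosh(σθ)·Id + (sinh(σθ)/σ)·X` on unstable classes (`σ² = −k²c²`) and `cos(ωθ)·Id + (sin(ωθ)/ω)·X` on stable ones — the θ-dependence of S2 is
  explicit and only a table in `(k, β)` remains;
* `sawSigma0_neg`, `normSq_sawS_lt_sq_sawSigma0` — `Σ₀ < 0` and `|S|² < Σ₀²` for `k > 0`, i.e. `m > |S|`: the Gram `M` is positive definite,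
  quantitatively `khGram_ge` (`qᴴMq ≥ (m − |S|)(|q₀|² + |q₁|²)`);
* `khBlock_energy_identity` — `2 Re(qᴴ M X q) = 2πk · Im(S q̄₀ q₁)` (the `Σ₀`-terms cancel since `p + 2m = π/2`): along `q′ = Xq` the sheet
  energy changes at rate `2πk Im(S q̄₀ q₁)`, whence the a-priori bound `|d/dθ log qᴴMq| ≤ πk|S|/(m − |S|)`.
No definitions; no statement about the crux. [cite: Drazin2002, §8.3 (8.36)–(8.38) (Rayleigh jump conditions at the kinks of a broken-line profile)] [problem: turb]
-/

-- `Summit.<Summit>.<Problem>`: single-conjunct summit, the duplicate namespace segment is deliberate.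
set_option linter.dupNamespace false

noncomputable section

namespace Summit.AnomalousDissipation.AnomalousDissipation.Theorems.SawtoothPulseCascade.K2PhaseBudget

open Set Real Complex Literature.Analysis.FluidPDE.SawtoothCascade

/-! ## §1 `X² = −k² c² · Id` -/

/-- **The sheet block squares to a scalar:** with `p = π/2 + 2Σ₀(k,β)`, `S = S_β(k)` and `X q = ik(−p q₀ − 2S q₁, 2S̄ q₀ + p q₁)`,
`X (X q) = −k²·c²(k,β)·q` componentwise (`c² = p² − 4|S|²` is the tree's `sawC2`). [cite: Drazin2002, §8.3 (8.36)–(8.38)] -/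
theorem khBlock_sq (k β : ℝ) {p S : ℂ} (hp : p = ((π / 2 + 2 * sawSigma0 k β : ℝ) : ℂ)) (hS : S = sawS k β) (q₀ q₁ : ℂ) :
    I * k * (-p * (I * k * (-p * q₀ - 2 * S * q₁)) - 2 * S * (I * k * (2 * (starRingEnd ℂ) S * q₀ + p * q₁))) =
      -(((k ^ 2 * sawC2 k β : ℝ) : ℂ)) * q₀ ∧
    I * k * (2 * (starRingEnd ℂ) S * (I * k * (-p * q₀ - 2 * S * q₁)) + p * (I * k * (2 * (starRingEnd ℂ) S * q₀ + p * q₁))) =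
      -(((k ^ 2 * sawC2 k β : ℝ) : ℂ)) * q₁ := by
  have hc2 : (((k ^ 2 * sawC2 k β : ℝ) : ℂ)) = (k : ℂ) ^ 2 * (p ^ 2 - 4 * (Complex.normSq S : ℂ)) := by
    rw [hp, hS]; unfold sawC2; push_cast; ring
  have hSS : S * (starRingEnd ℂ) S = (Complex.normSq S : ℂ) := Complex.mul_conj S
  rw [hc2]
  constructor
  · linear_combination ((k : ℂ) ^ 2 * (p ^ 2 * q₀ - 4 * S * (starRingEnd ℂ) S * q₀)) * Complex.I_sq +
      (4 * (k : ℂ) ^ 2 * q₀) * hSS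
  · linear_combination ((k : ℂ) ^ 2 * (p ^ 2 * q₁ - 4 * S * (starRingEnd ℂ) S * q₁)) * Complex.I_sq +
      (4 * (k : ℂ) ^ 2 * q₁) * hSS

/-! ## §2 The energy Gram `M = [[−Σ₀, −S], [−S̄, −Σ₀]]` is positive definite -/

/-- `Σ₀(k, β) < 0` for `k > 0` (`Σ₀ = −(1 − q²)/(2k(1 − 2q cos 2πβ + q²))`, `q = e^{−2πk} ∈ (0,1)`). [cite: Drazin2002, §8.3 (8.36)–(8.38)] -/
theorem sawSigma0_neg {k : ℝ} (hk : 0 < k) (β : ℝ) : sawSigma0 k β < 0 := by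
  unfold sawSigma0
  have hq0 : 0 < sawQ k := Real.exp_pos _
  have hq1 : sawQ k < 1 := sawQ_lt_one hk
  have hc := Real.cos_le_one (2 * π * β)
  have hD : 0 < 1 - 2 * sawQ k * Real.cos (2 * π * β) + sawQ k ^ 2 := by nlinarith
  have hnum : 0 < 1 - sawQ k ^ 2 := by nlinarith
  have hden : 0 < 2 * k * (1 - 2 * sawQ k * Real.cos (2 * π * β) + sawQ k ^ 2) := by positivity
  rw [neg_div]
  exact neg_neg_of_pos (div_pos hnum hden)

/-- `|S_β(k)|² < Σ₀(k,β)²` for `k > 0`: with `q = e^{−2πk}`, `|S|²·(2kD)² = q(1−q)²(2+2cos 2πβ) ≤ 4q(1−q)² < (1−q)²(1+q)² = (1−q²)² = Σ₀²·(2kD)²`.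
[cite: Drazin2002, §8.3 (8.36)–(8.38)] -/
theorem normSq_sawS_lt_sq_sawSigma0 {k : ℝ} (hk : 0 < k) (β : ℝ) :
    Complex.normSq (sawS k β) < sawSigma0 k β ^ 2 := by
  rw [normSq_sawS hk.ne' β]
  unfold sawSigma0
  have hq0 : 0 < sawQ k := Real.exp_pos _
  have hq1 : sawQ k < 1 := sawQ_lt_one hk
  have hE : Real.exp (-(k * π)) ^ 2 = sawQ k := by
    unfold sawQ; rw [← Real.exp_nat_mul]; congr 1; push_cast; ring
  have hc := Real.cos_le_one (2 * π * β)
  have hc' := Real.neg_one_le_cos (2 * π * β)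
  set q := sawQ k with hq_def
  set γ := Real.cos (2 * π * β) with hγ
  have hD : 0 < 1 - 2 * q * γ + q ^ 2 := by nlinarith
  have hk0 : (0 : ℝ) < 2 * k := by linarith
  have e1 : (Real.exp (-(k * π)) / (2 * k)) ^ 2 * ((1 - q) ^ 2 * (2 + 2 * γ)) / (1 - 2 * q * γ + q ^ 2) ^ 2 =
      q * ((1 - q) ^ 2 * (2 + 2 * γ)) / ((2 * k) ^ 2 * (1 - 2 * q * γ + q ^ 2) ^ 2) := by
    rw [div_pow, hE]
    field_simp
  have e2 : (-(1 - q ^ 2) / (2 * k * (1 - 2 * q * γ + q ^ 2))) ^ 2 =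
      (1 - q ^ 2) ^ 2 / ((2 * k) ^ 2 * (1 - 2 * q * γ + q ^ 2) ^ 2) := by
    rw [neg_div, neg_sq, div_pow, mul_pow]
  rw [e1, e2]
  apply div_lt_div_of_pos_right _ (by positivity)
  -- `q (1−q)² (2+2γ) ≤ 4 q (1−q)² < (1−q)²(1+q)² = (1−q²)²`
  have h1q : 0 < (1 - q) ^ 2 := by nlinarith
  nlinarith [mul_pos hq0 h1q, mul_nonneg hq0.le (mul_nonneg h1q.le (show 0 ≤ 1 - γ by linarith))]

/-- **Positive definiteness of the sheet Gram, quantitative:** for `k > 0` and all `q₀ q₁`,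
`(−Σ₀ − |S|)(|q₀|² + |q₁|²) ≤ −Σ₀ (|q₀|² + |q₁|²) − 2 Re(q̄₀ S q₁)` and `0 < −Σ₀ − |S|`. [cite: Drazin2002, §8.3 (8.36)–(8.38)] -/
theorem khGram_ge {k : ℝ} (hk : 0 < k) (β : ℝ) (q₀ q₁ : ℂ) :
    0 < -sawSigma0 k β - Real.sqrt (Complex.normSq (sawS k β)) ∧
    (-sawSigma0 k β - Real.sqrt (Complex.normSq (sawS k β))) * (Complex.normSq q₀ + Complex.normSq q₁) ≤
      -sawSigma0 k β * (Complex.normSq q₀ + Complex.normSq q₁) - 2 * ((starRingEnd ℂ) q₀ * sawS k β * q₁).re := by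
  have hm := sawSigma0_neg hk β
  have hlt := normSq_sawS_lt_sq_sawSigma0 hk β
  set S := sawS k β with hS_def
  set m := -sawSigma0 k β with hm_def
  have hm0 : 0 < m := by rw [hm_def]; linarith
  have habs : Real.sqrt (Complex.normSq S) < m := by
    rw [Real.sqrt_lt' hm0]
    have : m ^ 2 = sawSigma0 k β ^ 2 := by rw [hm_def]; ring
    rw [this]; exact hlt
  refine ⟨by linarith, ?_⟩
  -- `|Re(q̄₀ S q₁)| ≤ |q₀| |S| |q₁| ≤ |S| (|q₀|² + |q₁|²)/2`
  have hre : |((starRingEnd ℂ) q₀ * S * q₁).re| ≤ ‖q₀‖ * Real.sqrt (Complex.normSq S) * ‖q₁‖ := by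
    have h1 := Complex.abs_re_le_norm ((starRingEnd ℂ) q₀ * S * q₁)
    rw [norm_mul, norm_mul, Complex.norm_conj] at h1
    have h2 : ‖S‖ = Real.sqrt (Complex.normSq S) := rfl
    rw [← h2]
    linarith
  have hn0 : Complex.normSq q₀ = ‖q₀‖ ^ 2 := (Complex.sq_norm q₀).symm
  have hn1 : Complex.normSq q₁ = ‖q₁‖ ^ 2 := (Complex.sq_norm q₁).symm
  rw [hn0, hn1]
  have hs0 : 0 ≤ Real.sqrt (Complex.normSq S) := Real.sqrt_nonneg _
  have hamgm : 2 * (‖q₀‖ * Real.sqrt (Complex.normSq S) * ‖q₁‖) ≤ Real.sqrt (Complex.normSq S) * (‖q₀‖ ^ 2 + ‖q₁‖ ^ 2) := by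
    nlinarith [mul_nonneg hs0 (sq_nonneg (‖q₀‖ - ‖q₁‖))]
  have habs' := (abs_le.1 hre).2
  nlinarith

/-! ## §3 The energy identity of the sheet block -/

/-- **Energy identity:** with `m = −Σ₀`, `S = S_β(k)`, `p = π/2 + 2Σ₀ = π/2 − 2m` and `X` as above, for all `q₀ q₁`:
`2·Re( q̄₀ (m (Xq)₀ − S (Xq)₁) + q̄₁ (−S̄ (Xq)₀ + m (Xq)₁) ) = 2πk · Im(S q̄₀ q₁)` — i.e. along `q′ = Xq` the Gram energy `qᴴMq`
changes at rate `2πk Im(S q̄₀ q₁)`; the `Σ₀`-terms cancel because `p + 2m = π/2`. [cite: Drazin2002, §8.3 (8.36)–(8.38)] -/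
theorem khBlock_energy_identity (k β : ℝ) {p S : ℂ} {m : ℝ} (hp : p = ((π / 2 + 2 * sawSigma0 k β : ℝ) : ℂ))
    (hS : S = sawS k β) (hm : m = -sawSigma0 k β) (q₀ q₁ : ℂ) :
    2 * ((starRingEnd ℂ) q₀ * ((m : ℂ) * (I * k * (-p * q₀ - 2 * S * q₁)) - S * (I * k * (2 * (starRingEnd ℂ) S * q₀ + p * q₁)))
        + (starRingEnd ℂ) q₁ * (-(starRingEnd ℂ) S * (I * k * (-p * q₀ - 2 * S * q₁))
          + (m : ℂ) * (I * k * (2 * (starRingEnd ℂ) S * q₀ + p * q₁)))).re =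
      2 * π * k * (S * (starRingEnd ℂ) q₀ * q₁).im := by
  have hp' : p = ((π / 2 - 2 * m : ℝ) : ℂ) := by rw [hp, hm]; push_cast; ring
  subst hS
  rw [hp']
  have e1 : ∀ z : ℂ, ((starRingEnd ℂ) z).re = z.re := fun z => Complex.conj_re z
  have e2 : ∀ z : ℂ, ((starRingEnd ℂ) z).im = -z.im := fun z => Complex.conj_im z
  simp only [Complex.mul_re, Complex.mul_im, Complex.add_re, Complex.add_im, Complex.sub_re, Complex.sub_im,
    Complex.neg_re, Complex.neg_im, Complex.ofReal_re, Complex.ofReal_im, Complex.I_re, Complex.I_im, e1, e2,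
    Complex.re_ofNat, Complex.im_ofNat]
  ring

end Summit.AnomalousDissipation.AnomalousDissipation.Theorems.SawtoothPulseCascade.K2PhaseBudget

end
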